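import Literature.NumberTheory.LFunctions.WeilGroundEnergyProofs
import Literature.NumberTheory.LFunctions.WeilMellinVerticalCalculus
import HarnessLib

/-!
# Plancherel–Pólya / Bessel bound for samples of the Weil transform on the critical line

For a Weil test function `g` supported in `[-a, a]` write `f(u) = ĝ(1/2 + iu) = ∫ g(x) e^{iux} dx`
(`Literature.NumberTheory.LFunctions.weilMellin` on the critical line: an entire function of
exponential type `a`, square integrable on the real axis with `∫ |f|² = 2π ∫ |g|²`). For every
`s`-separated real family `Λ : ι → ℝ` (`|Λ_i - Λ_j| ≥ s > 0` for `i ≠ j`) the samples are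
square summable with the **Bessel (upper frame) bound**

  `Σ_i |f(Λ_i)|² ≤ (⌊1/s⌋ + 1) · 2π (2 + a²) · ∫ |g|²`

(`sum_norm_sq_weilMellin_line_le_of_separated` for finite partial sums,
`summable_norm_sq_weilMellin_line_of_separated`, `tsum_norm_sq_weilMellin_line_le_of_separated`).
This is the easy half of the Duffin–Schaeffer frame theorem (Duffin–Schaeffer 1952, Lemma II /
Theorem I; Plancherel–Pólya 1937; Young 2001, Ch. 2 Thm 17 and Ch. 4 Lemma 3), proved here by
the real-variable route: the `L¹` Sobolev bound on a unit cell `|f(x)|² ≤ ∫_cell (2|f|² + |f'|²)`,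
at most `⌊1/s⌋ + 1` sample points per cell, and Plancherel for `f` and `f' = (ix g)^`
(`integral_norm_sq_weilMellin_half_line`), `∫ |x g|² ≤ a² ∫ |g|²`.
The cell lemmas are adapted from the Summit-side file
`Summits/RiemannHypothesis/RiemannHypothesis/Theorems/WindowTraceArch/Negative/BoundedDensity.lean`
(which a Literature file may not import). Everything is proved; no definitions, no named facts.
-/

noncomputable section

open Complex Set MeasureTheory Filter intervalIntegral
open scoped Real Topology

namespace Literature.NumberTheory.LFunctions

variable {g : ℝ → ℂ}

/-! ### An `L¹` Sobolev bound on unit cells -/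

-- adapted from Summits/.../WindowTraceArch/Negative/BoundedDensity.lean (norm_le_intervalIntegral_add)
/-- For `F` with a continuous derivative `F'` and `x ∈ [c, c+1]`:
`‖F x‖ ≤ ∫_c^{c+1} ‖F‖ + ∫_c^{c+1} ‖F'‖`. [folklore] -/
private theorem norm_le_intervalIntegral_add_unitCell {F F' : ℝ → ℂ} (hF : ∀ x, HasDerivAt F (F' x) x)
    (hFc : Continuous F) (hF'c : Continuous F') {c x : ℝ} (hx : x ∈ Icc c (c + 1)) :
    ‖F x‖ ≤ (∫ y in c..c + 1, ‖F y‖) + ∫ y in c..c + 1, ‖F' y‖ := by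
  have hc1 : c ≤ c + 1 := by linarith
  set J : ℝ := ∫ y in c..c + 1, ‖F' y‖ with hJ
  have hnn : 0 ≤ᵐ[volume.restrict (Ioc c (c + 1))] fun t => ‖F' t‖ :=
    Eventually.of_forall fun _ => norm_nonneg _
  have hpt : ∀ y ∈ Icc c (c + 1), ‖F x‖ ≤ ‖F y‖ + J := by
    intro y hy
    have hFTC : ∫ t in y..x, F' t = F x - F y :=
      integral_eq_sub_of_hasDerivAt (fun t _ => hF t) (hF'c.intervalIntegrable _ _)
    have h1 : ‖F x - F y‖ ≤ J := by
      rw [← hFTC]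
      rcases le_total y x with hyx | hxy
      · calc ‖∫ t in y..x, F' t‖ ≤ ∫ t in y..x, ‖F' t‖ := norm_integral_le_integral_norm hyx
          _ ≤ J := integral_mono_interval hy.1 hyx hx.2 hnn (hF'c.norm.intervalIntegrable _ _)
      · rw [integral_symm, norm_neg]
        calc ‖∫ t in x..y, F' t‖ ≤ ∫ t in x..y, ‖F' t‖ := norm_integral_le_integral_norm hxy
          _ ≤ J := integral_mono_interval hx.1 hxy hy.2 hnn (hF'c.norm.intervalIntegrable _ _)
    calc ‖F x‖ = ‖F y + (F x - F y)‖ := by rw [add_sub_cancel]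
      _ ≤ ‖F y‖ + ‖F x - F y‖ := norm_add_le _ _
      _ ≤ ‖F y‖ + J := by linarith
  have hint : (∫ _ in c..c + 1, ‖F x‖) ≤ ∫ y in c..c + 1, (‖F y‖ + J) :=
    integral_mono_on hc1 intervalIntegrable_const
      ((hFc.norm.intervalIntegrable _ _).add intervalIntegrable_const) hpt
  rw [intervalIntegral.integral_const,
    intervalIntegral.integral_add (hFc.norm.intervalIntegrable _ _) intervalIntegrable_const,
    intervalIntegral.integral_const] at hint
  simpa using hint

-- adapted from Summits/.../WindowTraceArch/Negative/BoundedDensity.lean (norm_sq_le_intervalIntegral)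
/-- The square of a `C¹` function on a unit cell:
`‖f x‖² ≤ ∫_c^{c+1} (2‖f‖² + ‖f'‖²)` for `x ∈ [c, c+1]` (the `L¹` bound for `F = f²`,
`F' = 2 f f'`, and `2|f||f'| ≤ |f|² + |f'|²`). [folklore] -/
private theorem norm_sq_le_intervalIntegral_unitCell {f f' : ℝ → ℂ} (hf : ∀ x, HasDerivAt f (f' x) x)
    (hfc : Continuous f) (hf'c : Continuous f') {c x : ℝ} (hx : x ∈ Icc c (c + 1)) :
    ‖f x‖ ^ 2 ≤ ∫ y in c..c + 1, (2 * ‖f y‖ ^ 2 + ‖f' y‖ ^ 2) := by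
  have hc1 : c ≤ c + 1 := by linarith
  have hF : ∀ x, HasDerivAt (fun y => f y * f y) (f' x * f x + f x * f' x) x := fun x =>
    (hf x).mul (hf x)
  have h := norm_le_intervalIntegral_add_unitCell hF (hfc.mul hfc)
    ((hf'c.mul hfc).add (hfc.mul hf'c)) hx
  rw [norm_mul, ← sq] at h
  refine h.trans ?_
  have hi1 : IntervalIntegrable (fun y => ‖f y * f y‖) volume c (c + 1) :=
    (hfc.mul hfc).norm.intervalIntegrable _ _
  have hi2 : IntervalIntegrable (fun y => ‖f' y * f y + f y * f' y‖) volume c (c + 1) :=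
    ((hf'c.mul hfc).add (hfc.mul hf'c)).norm.intervalIntegrable _ _
  rw [← intervalIntegral.integral_add hi1 hi2]
  refine intervalIntegral.integral_mono_on hc1 (hi1.add hi2) ?_ fun y _ => ?_
  · exact ((continuous_const.mul (hfc.norm.pow 2)).add (hf'c.norm.pow 2)).intervalIntegrable _ _
  · have h2 : ‖f' y * f y + f y * f' y‖ ≤ ‖f' y‖ * ‖f y‖ + ‖f y‖ * ‖f' y‖ :=
      (norm_add_le _ _).trans (by rw [norm_mul, norm_mul])
    rw [norm_mul, ← sq]
    nlinarith [sq_nonneg (‖f y‖ - ‖f' y‖), norm_nonneg (f y), norm_nonneg (f' y)]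

/-! ### Separated families: at most `⌊1/s⌋ + 1` points per unit cell -/

-- adapted from Summits/.../WindowTraceArch/Negative/BoundedDensity.lean (exists_finset_cell_of_separated)
/-- An `s`-separated real family has at most `⌊1/s⌋₊ + 1` points in each unit cell `[k, k+1)`
(pigeonhole on `i ↦ ⌊(Λ_i - k)/s⌋₊`). [folklore] -/
theorem exists_finset_unitCell_of_separated {ι : Type*} {Λ : ι → ℝ} {s : ℝ} (hs : 0 < s)
    (hsep : Pairwise fun i j => s ≤ |Λ i - Λ j|) (k : ℤ) :
    ∃ t : Finset ι, t.card ≤ ⌊1 / s⌋₊ + 1 ∧ ∀ i, Λ i ∈ Set.Ico (k : ℝ) (k + 1) → i ∈ t := by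
  classical
  set C : Set ι := {i | Λ i ∈ Set.Ico (k : ℝ) (k + 1)} with hC
  set φ : ι → ℕ := fun i => ⌊(Λ i - k) / s⌋₊ with hφ
  have hinj : Set.InjOn φ C := by
    intro i hi j hj hij
    by_contra hne
    have hs' : s ≤ |Λ i - Λ j| := hsep hne
    have hi0 : 0 ≤ (Λ i - k) / s := div_nonneg (by linarith [hi.1]) hs.le
    have hj0 : 0 ≤ (Λ j - k) / s := div_nonneg (by linarith [hj.1]) hs.le
    obtain ⟨h1, h2⟩ := (Nat.floor_eq_iff hi0).1 rfl
    obtain ⟨h3, h4⟩ := (Nat.floor_eq_iff hj0).1 rfl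
    have hij' : (⌊(Λ i - k) / s⌋₊ : ℝ) = ⌊(Λ j - k) / s⌋₊ := by exact_mod_cast hij
    have hlt : |(Λ i - k) / s - (Λ j - k) / s| < 1 := by
      rw [abs_lt]; constructor <;> linarith
    have heq : (Λ i - k) / s - (Λ j - k) / s = (Λ i - Λ j) / s := by ring
    rw [heq, abs_div, abs_of_pos hs, div_lt_one hs] at hlt
    linarith
  have hmaps : Set.MapsTo φ C (Finset.range (⌊1 / s⌋₊ + 1) : Finset ℕ) := by
    intro i hi
    rw [Finset.coe_range, Set.mem_Iio, Nat.lt_add_one_iff]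
    refine Nat.floor_le_floor ?_
    rw [div_le_div_iff_of_pos_right hs]
    linarith [hi.2]
  have hfin : C.Finite :=
    Set.Finite.of_finite_image ((Finset.finite_toSet _).subset hmaps.image_subset) hinj
  refine ⟨hfin.toFinset, ?_, fun i hi => hfin.mem_toFinset.2 hi⟩
  have hcard := Finset.card_le_card_of_injOn φ (s := hfin.toFinset)
    (t := Finset.range (⌊1 / s⌋₊ + 1)) (fun i hi => hmaps (hfin.mem_toFinset.1 hi))
    (fun i hi j hj hij => hinj (hfin.mem_toFinset.1 hi) (hfin.mem_toFinset.1 hj) hij)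
  simpa using hcard

/-! ### The weighted norm `∫ |x g(x)|²` on a window -/

/-- For `g` supported in `[-a, a]`: `∫ |i x g(x)|² ≤ a² ∫ |g|²`. [folklore] -/
theorem weilNorm2Sq_I_mul_le (hg : IsWeilTest g) {a : ℝ} (hga : tsupport g ⊆ Icc (-a) a) :
    weilNorm2Sq (fun x : ℝ => I * x * g x) ≤ a ^ 2 * weilNorm2Sq g := by
  unfold weilNorm2Sq
  rw [← MeasureTheory.integral_const_mul]
  refine integral_mono hg.I_mul.integrable_norm_sq (hg.integrable_norm_sq.const_mul _) fun t => ?_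
  by_cases ht : t ∈ tsupport g
  · have ht' := hga ht
    simp only [norm_mul, Complex.norm_I, one_mul, Complex.norm_real, Real.norm_eq_abs, mul_pow,
      sq_abs]
    have : t ^ 2 ≤ a ^ 2 := by nlinarith [ht'.1, ht'.2]
    exact mul_le_mul_of_nonneg_right this (sq_nonneg _)
  · simp [image_eq_zero_of_notMem_tsupport ht]

/-! ### The Bessel bound -/

/-- **Plancherel–Pólya / Bessel bound for separated samples (finite form).** For a Weil test
function `g` supported in `[-a, a]` and an `s`-separated real family `Λ`, every finite partial
sum of `|ĝ(1/2 + iΛ_i)|²` is at most `(⌊1/s⌋ + 1) · 2π(2 + a²) · ∫ |g|²`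
(Duffin–Schaeffer 1952, Lemma II and the remark after it; Young 2001 Ch. 4 §3 Lemma 3 /
Ch. 2 Thm 17). [cite: DuffinSchaeffer1952, Lemma II] -/
theorem sum_norm_sq_weilMellin_line_le_of_separated {ι : Type*} {Λ : ι → ℝ} {s : ℝ}
    (hs : 0 < s) (hsep : Pairwise fun i j => s ≤ |Λ i - Λ j|) (hg : IsWeilTest g) {a : ℝ}
    (hga : tsupport g ⊆ Icc (-a) a) (T : Finset ι) :
    ∑ i ∈ T, ‖weilMellin g (1 / 2 + Λ i * I)‖ ^ 2 ≤
      ((⌊1 / s⌋₊ + 1 : ℕ) : ℝ) * (2 * π * (2 + a ^ 2)) * ∫ x, ‖g x‖ ^ 2 := by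
  classical
  set D : ℕ := ⌊1 / s⌋₊ + 1 with hD_def
  choose S hScard hSmem using exists_finset_unitCell_of_separated hs hsep
  -- the line function and its derivative
  set f : ℝ → ℂ := fun v => weilMellin g (1 / 2 + v * I) with hf_def
  set gh : ℝ → ℂ := fun x : ℝ => I * x * g x with hgh_def
  have hgh : IsWeilTest gh := hg.I_mul
  set f' : ℝ → ℂ := fun v => weilMellin gh (1 / 2 + v * I) with hf'_def
  have hder : ∀ v, HasDerivAt f (f' v) v := fun v =>
    hasDerivAt_weilMellin_vertical hg.1.continuous hg.2 v
  have hfc : Continuous f := (continuous_weilMellin hg.1.continuous hg.2).comp (by fun_prop)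
  have hf'c : Continuous f' := (continuous_weilMellin hgh.1.continuous hgh.2).comp (by fun_prop)
  set φ : ℝ → ℝ := fun v => 2 * ‖f v‖ ^ 2 + ‖f' v‖ ^ 2 with hφ_def
  have hφnn : ∀ v, 0 ≤ φ v := fun v => by positivity
  -- integrability and the value of `∫ φ`
  have hif : Integrable fun v => ‖f v‖ ^ 2 := integrable_norm_sq_weilMellin_half_line hg
  have hif' : Integrable fun v => ‖f' v‖ ^ 2 := integrable_norm_sq_weilMellin_half_line hgh
  have hiφ : Integrable φ := (hif.const_mul 2).add hif'
  have hB : ∫ v, φ v ≤ 2 * π * (2 + a ^ 2) * weilNorm2Sq g := by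
    have e1 : ∫ v, ‖f v‖ ^ 2 = 2 * π * weilNorm2Sq g := integral_norm_sq_weilMellin_half_line hg
    have e2 : ∫ v, ‖f' v‖ ^ 2 = 2 * π * weilNorm2Sq gh := integral_norm_sq_weilMellin_half_line hgh
    show ∫ v, (2 * ‖f v‖ ^ 2 + ‖f' v‖ ^ 2) ≤ _
    rw [integral_add (hif.const_mul 2) hif', MeasureTheory.integral_const_mul, e1, e2]
    have h1 := weilNorm2Sq_I_mul_le hg hga
    have h2 := weilNorm2Sq_nonneg g
    nlinarith [Real.pi_pos]
  -- the cells: `b k = ∫_k^{k+1} φ`, summing to `∫ φ`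
  set b : ℤ → ℝ := fun k => ∫ v in (k : ℝ)..(k : ℝ) + 1, φ v with hb_def
  have hb_nonneg : ∀ k, 0 ≤ b k := fun k =>
    intervalIntegral.integral_nonneg (by linarith) fun v _ => hφnn v
  have hbsum : HasSum b (∫ v, φ v) := by
    have h1 := hasSum_integral_iUnion (μ := volume) (f := φ)
      (s := fun k : ℤ => Ioc (k : ℝ) (k + 1)) (fun k => measurableSet_Ioc)
      (pairwise_disjoint_Ioc_intCast ℝ) hiφ.integrableOn
    rw [iUnion_Ioc_intCast, setIntegral_univ] at h1
    refine h1.congr_fun fun k => ?_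
    show (∫ v in (k : ℝ)..(k : ℝ) + 1, φ v) = ∫ v in Ioc (k : ℝ) (k + 1), φ v
    exact intervalIntegral.integral_of_le (by linarith)
  -- pointwise Sobolev: `‖f x‖² ≤ b ⌊x⌋`
  have hpt : ∀ x : ℝ, ‖f x‖ ^ 2 ≤ b ⌊x⌋ := fun x =>
    norm_sq_le_intervalIntegral_unitCell hder hfc hf'c ⟨Int.floor_le x, (Int.lt_floor_add_one x).le⟩
  -- the partial sum is `≤ D · ∫ φ`
  set t : Finset ℤ := T.image fun i => ⌊Λ i⌋ with ht_def
  have hmaps : ∀ i ∈ T, ⌊Λ i⌋ ∈ t := fun i hi => Finset.mem_image_of_mem _ hi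
  have hsum : ∑ i ∈ T, ‖f (Λ i)‖ ^ 2 ≤ D * ∫ v, φ v := by
    rw [← Finset.sum_fiberwise_of_maps_to hmaps]
    calc ∑ k ∈ t, ∑ i ∈ T with ⌊Λ i⌋ = k, ‖f (Λ i)‖ ^ 2
        ≤ ∑ k ∈ t, ∑ i ∈ T with ⌊Λ i⌋ = k, b k := by
          refine Finset.sum_le_sum fun k _ => Finset.sum_le_sum fun i hi => ?_
          rw [Finset.mem_filter] at hi
          rw [← hi.2]
          exact hpt (Λ i)
      _ = ∑ k ∈ t, ((T.filter fun i => ⌊Λ i⌋ = k).card : ℝ) * b k := by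
          simp [Finset.sum_const, nsmul_eq_mul]
      _ ≤ ∑ k ∈ t, (D : ℝ) * b k := by
          refine Finset.sum_le_sum fun k _ => mul_le_mul_of_nonneg_right ?_ (hb_nonneg k)
          have hsub : (T.filter fun i => ⌊Λ i⌋ = k) ⊆ S k := by
            intro i hi
            rw [Finset.mem_filter] at hi
            exact hSmem k i (Int.floor_eq_iff.1 hi.2)
          exact_mod_cast (Finset.card_le_card hsub).trans (hScard k)
      _ = (D : ℝ) * ∑ k ∈ t, b k := by rw [Finset.mul_sum]
      _ ≤ (D : ℝ) * ∫ v, φ v :=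
          mul_le_mul_of_nonneg_left (sum_le_hasSum t (fun k _ => hb_nonneg k) hbsum)
            (Nat.cast_nonneg D)
  calc ∑ i ∈ T, ‖f (Λ i)‖ ^ 2 ≤ D * ∫ v, φ v := hsum
    _ ≤ D * (2 * π * (2 + a ^ 2) * weilNorm2Sq g) :=
        mul_le_mul_of_nonneg_left hB (Nat.cast_nonneg D)
    _ = (D : ℝ) * (2 * π * (2 + a ^ 2)) * ∫ x, ‖g x‖ ^ 2 := by rw [weilNorm2Sq]; ring

/-- **Square summability of separated samples.** For a Weil test function `g` and an
`s`-separated real family `Λ`, `Σ_i |ĝ(1/2 + iΛ_i)|² < ∞` (Plancherel–Pólya 1937;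
Duffin–Schaeffer 1952 Lemma II). [cite: DuffinSchaeffer1952, Lemma II] -/
theorem summable_norm_sq_weilMellin_line_of_separated {ι : Type*} {Λ : ι → ℝ} {s : ℝ}
    (hs : 0 < s) (hsep : Pairwise fun i j => s ≤ |Λ i - Λ j|) (hg : IsWeilTest g) :
    Summable fun i => ‖weilMellin g (1 / 2 + Λ i * I)‖ ^ 2 := by
  obtain ⟨a, ha⟩ : ∃ a : ℝ, tsupport g ⊆ Icc (-a) a := by
    obtain ⟨r, hr⟩ := hg.2.isCompact.isBounded.subset_closedBall 0
    exact ⟨r, by simpa [Real.closedBall_eq_Icc] using hr⟩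
  exact summable_of_sum_le (fun i => by positivity)
    (sum_norm_sq_weilMellin_line_le_of_separated hs hsep hg ha)

/-- **Bessel bound for separated samples (series form).** For a Weil test function `g`
supported in `[-a, a]` and an `s`-separated real family `Λ`:
`Σ_i |ĝ(1/2 + iΛ_i)|² ≤ (⌊1/s⌋ + 1) · 2π(2 + a²) · ∫ |g|²` (Duffin–Schaeffer 1952, the
constant `B` of Theorem I). [cite: DuffinSchaeffer1952, Theorem I (upper bound)] -/
theorem tsum_norm_sq_weilMellin_line_le_of_separated {ι : Type*} {Λ : ι → ℝ} {s : ℝ}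
    (hs : 0 < s) (hsep : Pairwise fun i j => s ≤ |Λ i - Λ j|) (hg : IsWeilTest g) {a : ℝ}
    (hga : tsupport g ⊆ Icc (-a) a) :
    ∑' i, ‖weilMellin g (1 / 2 + Λ i * I)‖ ^ 2 ≤
      ((⌊1 / s⌋₊ + 1 : ℕ) : ℝ) * (2 * π * (2 + a ^ 2)) * ∫ x, ‖g x‖ ^ 2 :=
  (summable_norm_sq_weilMellin_line_of_separated hs hsep hg).tsum_le_of_sum_le
    (sum_norm_sq_weilMellin_line_le_of_separated hs hsep hg hga)

end Literature.NumberTheory.LFunctions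

end
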